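import Mathlib
import Summits.Ventures.PercRepro2.Defs
import Summits.Ventures.PercRepro2.Independence
import Summits.Ventures.PercRepro2.Harris
import Summits.Ventures.PercRepro2.Graph
import Summits.Ventures.PercRepro2.Exploration
import Summits.Ventures.PercRepro2.Events
import Summits.Ventures.PercRepro2.FourFunctions
import Summits.Ventures.PercRepro2.Induced
import Summits.Ventures.PercRepro2.Frontier
import Summits.Ventures.PercRepro2.ObsIndependence
import Summits.Ventures.PercRepro2.BHK
import Summits.Ventures.PercRepro2.BHKEvents

/-!
# Order preservation under increasing cluster events (blind cell PercRepro2, p1; row R10/R10f)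

For vertices `o, a`, an up-set `𝓤` (the event `E = {C(o) ∈ 𝓤}`, e.g. `{o ↔ A}` or
`{|C(o)| ≥ k}`) and an up-set `𝓥` (the cluster property `f(x) = 1{C(x) ∈ 𝓥}`, e.g. `{x ↔ b}`):

  `P(C(a) ∈ 𝓥) ≤ P(C(o) ∈ 𝓥)   ⟹   P(C(o) ∈ 𝓤, C(a) ∈ 𝓥) ≤ P(C(o) ∈ 𝓤, C(o) ∈ 𝓥)`

(`orderPreserving_cluster`), and its connection case (`orderPreserving_conn`):
`P(a ↔ b) ≤ P(o ↔ b) ⟹ P(E ∩ {a ↔ b}) ≤ P(E ∩ {o ↔ b})`.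

Proof (proofs/LEAD-PROOFSHAPES.md §5): on `{o ↔ a}` the two clusters coincide, so everything
reduces to the event `D = {o ↮ a}`; there the same-cluster BHK inequality
(`bhk_same_cluster_events`) bounds `P(C(o)∈𝓤, C(o)∈𝓥, D)·P(D)` from below and the cross-cluster
inequality (`bhk_cross_cluster`) bounds `P(C(o)∈𝓤, C(a)∈𝓥, D)·P(D)` from above, by the same
quantity `P(C(o)∈𝓤, D)·P(C(·)∈𝓥, D)` up to the hypothesis.
-/

namespace Summit.Ventures.PercRepro2

section OrderPreservation

variable {V : Type*} {E : Type*} [Fintype E] [DecidableEq E] [Fintype V] [DecidableEq V]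
  {R : Type*} [CommRing R] [LinearOrder R] [IsStrictOrderedRing R]

omit [Fintype E] [DecidableEq E] [Fintype V] [DecidableEq V] [LinearOrder R]
  [IsStrictOrderedRing R] in
/-- Dividing an inequality `x · d ≤ y · d` by a probability `d` that dominates `x`. -/
lemma le_of_mul_le_mul_of_le {x y d : R} [LinearOrder R] [IsStrictOrderedRing R] (hx : x ≤ d)
    (hx0 : 0 ≤ x) (hy0 : 0 ≤ y) (hd : 0 ≤ d) (h : x * d ≤ y * d) : x ≤ y := by
  rcases hd.lt_or_eq with hd | hd
  · exact le_of_mul_le_mul_right h hd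
  · subst hd
    exact (le_antisymm hx hx0).le.trans hy0

omit [Fintype E] [DecidableEq E] [Fintype V] [DecidableEq V] in
/-- On `{o ↔ a}`, `{C(a) ∈ 𝓥}` and `{C(o) ∈ 𝓥}` coincide. -/
lemma clusterInEvent_inter_connEvent_eq (ends : E → Sym2 V) (o a : V) (𝓥 : Set (Set V))
    (A : Set (Config E)) :
    clusterInEvent ends a 𝓥 ∩ A ∩ connEvent ends o a =
      clusterInEvent ends o 𝓥 ∩ A ∩ connEvent ends o a := by
  ext ω
  simp only [Set.mem_inter_iff, mem_clusterInEvent, mem_connEvent]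
  constructor
  · rintro ⟨⟨h1, h2⟩, h3⟩
    exact ⟨⟨by rwa [cluster_eq_of_conn h3], h2⟩, h3⟩
  · rintro ⟨⟨h1, h2⟩, h3⟩
    exact ⟨⟨by rwa [← cluster_eq_of_conn h3], h2⟩, h3⟩

/-- **R10f — order preservation under increasing cluster events**: for up-sets `𝓤, 𝓥`,
`P(C(a) ∈ 𝓥) ≤ P(C(o) ∈ 𝓥)` implies `P(C(o) ∈ 𝓤, C(a) ∈ 𝓥) ≤ P(C(o) ∈ 𝓤, C(o) ∈ 𝓥)`. -/
theorem orderPreserving_cluster (p : E → R) (hp : IsProbVec p) (ends : E → Sym2 V) (o a : V)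
    {𝓤 𝓥 : Set (Set V)} (h𝓤 : IsUpperSet 𝓤) (h𝓥 : IsUpperSet 𝓥)
    (h : prob p (clusterInEvent ends a 𝓥) ≤ prob p (clusterInEvent ends o 𝓥)) :
    prob p (clusterInEvent ends o 𝓤 ∩ clusterInEvent ends a 𝓥) ≤
      prob p (clusterInEvent ends o 𝓤 ∩ clusterInEvent ends o 𝓥) := by
  set D := (connEvent ends o a)ᶜ with hD
  -- split each probability along `{o ↔ a}` / `D`
  have s1 := prob_inter_add_prob_inter_compl p (clusterInEvent ends a 𝓥) (connEvent ends o a)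
  have s2 := prob_inter_add_prob_inter_compl p (clusterInEvent ends o 𝓥) (connEvent ends o a)
  have s3 := prob_inter_add_prob_inter_compl p (clusterInEvent ends o 𝓤 ∩ clusterInEvent ends a 𝓥)
    (connEvent ends o a)
  have s4 := prob_inter_add_prob_inter_compl p (clusterInEvent ends o 𝓤 ∩ clusterInEvent ends o 𝓥)
    (connEvent ends o a)
  -- on `{o ↔ a}` the clusters coincide
  have c1 : clusterInEvent ends a 𝓥 ∩ connEvent ends o a =
      clusterInEvent ends o 𝓥 ∩ connEvent ends o a := by
    have := clusterInEvent_inter_connEvent_eq ends o a 𝓥 Set.univ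
    simpa only [Set.inter_univ] using this
  have c2 : clusterInEvent ends o 𝓤 ∩ clusterInEvent ends a 𝓥 ∩ connEvent ends o a =
      clusterInEvent ends o 𝓤 ∩ clusterInEvent ends o 𝓥 ∩ connEvent ends o a := by
    rw [Set.inter_comm (clusterInEvent ends o 𝓤) (clusterInEvent ends a 𝓥),
      Set.inter_comm (clusterInEvent ends o 𝓤) (clusterInEvent ends o 𝓥)]
    exact clusterInEvent_inter_connEvent_eq ends o a 𝓥 _
  rw [c1] at s1
  rw [c2] at s3
  -- the reduced hypothesis and claim on `D`
  have hD' : prob p (clusterInEvent ends a 𝓥 ∩ D) ≤ prob p (clusterInEvent ends o 𝓥 ∩ D) := by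
    linarith
  suffices hmain : prob p (clusterInEvent ends o 𝓤 ∩ clusterInEvent ends a 𝓥 ∩ D) ≤
      prob p (clusterInEvent ends o 𝓤 ∩ clusterInEvent ends o 𝓥 ∩ D) by linarith
  -- the two BHK inequalities
  have hcross := bhk_cross_cluster p hp ends o a h𝓤 h𝓥
  have hsame := bhk_same_cluster_events p hp ends o a h𝓤 h𝓥
  have hmid : prob p (clusterInEvent ends o 𝓤 ∩ D) * prob p (clusterInEvent ends a 𝓥 ∩ D) ≤
      prob p (clusterInEvent ends o 𝓤 ∩ D) * prob p (clusterInEvent ends o 𝓥 ∩ D) :=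
    mul_le_mul_of_nonneg_left hD' (prob_nonneg hp _)
  refine le_of_mul_le_mul_of_le (prob_mono hp Set.inter_subset_right) (prob_nonneg hp _)
    (prob_nonneg hp _) (prob_nonneg hp _) ?_
  exact hcross.trans (hmid.trans hsame)

omit [Fintype E] [DecidableEq E] [Fintype V] [DecidableEq V] in
/-- `{x ↔ b}` is the cluster event of the up-set `{W | b ∈ W}`. -/
lemma connEvent_eq_clusterInEvent (ends : E → Sym2 V) (x b : V) :
    connEvent ends x b = clusterInEvent ends x {W | b ∈ W} := by
  ext ω
  simp [clusterInEvent]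

omit [Fintype E] [DecidableEq E] [Fintype V] [DecidableEq V] in
/-- `{W | b ∈ W}` is an up-set. -/
lemma isUpperSet_mem_setOf (b : V) : IsUpperSet {W : Set V | b ∈ W} :=
  fun _ _ h hb => h hb

/-- **R10 — order preservation, connection case**: for an up-set `𝓤` (the event `{C(o) ∈ 𝓤}`),
`P(a ↔ b) ≤ P(o ↔ b)` implies `P(C(o) ∈ 𝓤, a ↔ b) ≤ P(C(o) ∈ 𝓤, o ↔ b)`. -/
theorem orderPreserving_conn (p : E → R) (hp : IsProbVec p) (ends : E → Sym2 V) (o a b : V)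
    {𝓤 : Set (Set V)} (h𝓤 : IsUpperSet 𝓤)
    (h : prob p (connEvent ends a b) ≤ prob p (connEvent ends o b)) :
    prob p (clusterInEvent ends o 𝓤 ∩ connEvent ends a b) ≤
      prob p (clusterInEvent ends o 𝓤 ∩ connEvent ends o b) := by
  rw [connEvent_eq_clusterInEvent ends a b, connEvent_eq_clusterInEvent ends o b] at h ⊢
  exact orderPreserving_cluster p hp ends o a h𝓤 (isUpperSet_mem_setOf b) h

omit [Fintype E] [DecidableEq E] [Fintype V] [DecidableEq V] in
/-- `{o ↔ A}` is the cluster event of the up-set `{W | ∃ a ∈ A, a ∈ W}`. -/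
lemma hitEvent_eq_clusterInEvent (ends : E → Sym2 V) (o : V) (A : Finset V) :
    hitEvent ends o A = clusterInEvent ends o {W | ∃ a ∈ A, a ∈ W} := by
  ext ω
  simp [clusterInEvent]

omit [Fintype E] [DecidableEq E] [Fintype V] [DecidableEq V] in
/-- `{W | ∃ a ∈ A, a ∈ W}` is an up-set. -/
lemma isUpperSet_hitFamily (A : Finset V) : IsUpperSet {W : Set V | ∃ a ∈ A, a ∈ W} :=
  fun _ _ h ⟨a, ha, haW⟩ => ⟨a, ha, h haW⟩

/-- **R10 for the hitting event `E = {o ↔ A}`**: `P(a ↔ b) ≤ P(o ↔ b)` implies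
`P(o ↔ A, a ↔ b) ≤ P(o ↔ A, o ↔ b)`. In particular the Kozma–Nitzan pre-FKG inequality (3)
holds as soon as some `a ∈ A` has `P(a ↔ b) ≤ P(o ↔ b)`. -/
theorem orderPreserving_hit (p : E → R) (hp : IsProbVec p) (ends : E → Sym2 V) (o a b : V)
    (A : Finset V) (h : prob p (connEvent ends a b) ≤ prob p (connEvent ends o b)) :
    prob p (hitEvent ends o A ∩ connEvent ends a b) ≤
      prob p (hitEvent ends o A ∩ connEvent ends o b) := by
  rw [hitEvent_eq_clusterInEvent]
  exact orderPreserving_conn p hp ends o a b (isUpperSet_hitFamily A) h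

end OrderPreservation

end Summit.Ventures.PercRepro2
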